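/-
Copyright: cell pub-balaban-gaps (YM BLITZ Y1, track G1), seat g1-p2 GEN 7 (unit `pub-balaban-gaps-g1-p2`).  Row (D4) NODE O,
OBJECT level, FIBRE ALGEBRA of [B9] (3.51)–(3.54): the transport defect `W = R(U) − 1` (`R(U)X = UXU⁻¹`) as a matrix on the fibre
`Fin N × Fin N`, its BOND window from row ∕ column sums of `U − 1`, `U⁻¹ − 1`, and the DIVERGENCE identity for a pair of consecutive
bonds — first order `ad_{U − V}` (the discrete derivative of the transporter), second order `O(δ²)` — with its window.  Part 2
(`D4WalkBlockTransportWindows`) feeds these into `D4WalkBlockCovariantShift`.  HONEST FRAMING: elementary matrix algebra; nothing of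
Bałaban's asserted; (D4) instance 0∕1; NOT BetaPertH, NOT continuum, NOT Clay.
-/
import Summits.QuantumFields.BalabanUV.Gaps.D4WalkBlock

/-!
# `Gaps.D4WalkBlockTransportAlgebra` — transport defects on the fibre: conjugation operators, the bond window, the divergence
# identity and window (cell pub-balaban-gaps, seat g1-p2 gen 7)

HONEST DEPENDENCY (cell pub-balaban, verbatim): continuum YM on T⁴ ⇐ BetaPertH ∧ nine spine estimates (0/9 proved);
BetaPertH ⇐ (D1) ∧ (D4) ∧ CAP+tail.

* §1 `conjOp M M′` (`X ↦ MXM′`; `(conjOp M M′)_{(a,b),(c,d)} = M_{ac}M′_{db}`), bilinearity, `conjOp 1 1 = 1`, `rowMass_conjOp`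
  (fibre row mass = `rowSum(M)·colSum(M′)`), product bounds `colSumNorm_mul_le` ∕ `rowSumNorm_mul_le`.
* §2 **`rowMass_defect_le(_of_letters)`** — the BOND window: `conjOp U U⁻ − 1 = conjOp (U − 1) U⁻ + conjOp 1 (U⁻ − 1)`, row mass
  `≤ rowSum(U − 1)·colSum(U⁻) + colSum(U⁻ − 1) ≤ δ(1 + δ) + δ`.
* §3 **`defect_pair_eq`** (`UU⁻ = 1`, `V⁻V = 1` ⟹ `(conjOp U U⁻ − 1) + (conjOp V⁻ V − 1) = conjOp (U − V) 1 − conjOp 1 (U − V) + R₂`),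
  **`rowMass_defect_pair_le`** (`≤ 2δ′ + 4δ²`; `δ′` = row ∕ column sums of the discrete derivative `U − V` — print's `|∇A|` window).
References: T. Bałaban, Comm. Math. Phys. **99** (1985) 389–434 [B9], p. 390 («R(U)X = UXU⁻¹»), (3.37) p. 396, (3.51)–(3.54) pp. 400–401.
-/

noncomputable section

namespace Summit.QuantumFields.BalabanUV.Gaps.D4WalkBlockTransportAlgebra

open Metric Set Finset
open scoped Matrix
open Literature.MathematicalPhysics.QuantumFieldTheory.Balaban1983to89
open Literature.MathematicalPhysics.QuantumFieldTheory.Balaban1983to89.B9SectDWalk (DomBy)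
open Literature.MathematicalPhysics.QuantumFieldTheory.Balaban1983to89.B9Thm34Ext (toB6)
open Literature.MathematicalPhysics.QuantumFieldTheory.Balaban1983to89.B9Thm37GlueTorus (torusGeom tdist1)
open Literature.MathematicalPhysics.QuantumFieldTheory.Balaban1983to89.TreeLengthTorus (TPt)
open Literature.MathematicalPhysics.QuantumFieldTheory.Balaban1983to89.B5TorusCover (UT)
open Literature.MathematicalPhysics.QuantumFieldTheory.Balaban1983to89.B11SectG (RowSum)
open Summit.QuantumFields.BalabanUV.Gaps.D4WalkBlock (blockNorm BlockWalkExpansion)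

variable {N : ℕ}

/-! ## §1. The conjugation operators on the fibre `Fin N × Fin N` and their row masses -/

/-- The fibre operator `X ↦ M X M′` as a matrix on the index `Fin N × Fin N`: `(conjOp M M′)_{(a,b),(c,d)} = M_{ac}·M′_{db}` (so that
`R(U) = conjOp U U⁻¹`). [cite: Balaban1985BackgroundPropagators, p.390 («R(U)X = UXU⁻¹»), (3.50) p.400] -/
def conjOp (M M' : Matrix (Fin N) (Fin N) ℂ) : Matrix (Fin N × Fin N) (Fin N × Fin N) ℂ :=
  Matrix.of fun p q => M p.1 q.1 * M' q.2 p.2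

/-- `conjOp M M′` acts as `X ↦ MXM′`. -/
theorem conjOp_mulVec (M M' : Matrix (Fin N) (Fin N) ℂ) (X : Fin N × Fin N → ℂ) (p : Fin N × Fin N) :
    (conjOp M M' *ᵥ X) p = (M * Matrix.of (fun c d => X (c, d)) * M') p.1 p.2 := by
  simp only [Matrix.mulVec, dotProduct, conjOp, Matrix.of_apply, Matrix.mul_apply, Finset.sum_mul]
  rw [Fintype.sum_prod_type, Finset.sum_comm]
  refine Finset.sum_congr rfl fun d _ => Finset.sum_congr rfl fun c _ => by ring

/-- the row sum `Σ_c |M_{ac}|`. -/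
def rowSumNorm (M : Matrix (Fin N) (Fin N) ℂ) (a : Fin N) : ℝ := ∑ c, ‖M a c‖

/-- the column sum `Σ_d |M_{db}|`. -/
def colSumNorm (M : Matrix (Fin N) (Fin N) ℂ) (b : Fin N) : ℝ := ∑ d, ‖M d b‖

/-- row sums are non-negative. -/
theorem rowSumNorm_nonneg (M : Matrix (Fin N) (Fin N) ℂ) (a : Fin N) : 0 ≤ rowSumNorm M a :=
  Finset.sum_nonneg fun _ _ => norm_nonneg _

/-- column sums are non-negative. -/
theorem colSumNorm_nonneg (M : Matrix (Fin N) (Fin N) ℂ) (b : Fin N) : 0 ≤ colSumNorm M b :=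
  Finset.sum_nonneg fun _ _ => norm_nonneg _

/-- **Fibre row mass of `conjOp M M′`** at row `(a, b)` = `rowSum(M)_a · colSum(M′)_b`. -/
theorem rowMass_conjOp (M M' : Matrix (Fin N) (Fin N) ℂ) (a b : Fin N) :
    ∑ q : Fin N × Fin N, ‖conjOp M M' (a, b) q‖ = rowSumNorm M a * colSumNorm M' b := by
  simp only [conjOp, Matrix.of_apply, norm_mul, rowSumNorm, colSumNorm]
  rw [Fintype.sum_prod_type, Finset.sum_mul]
  refine Finset.sum_congr rfl fun c _ => by rw [Finset.mul_sum]

/-- `conjOp` is additive in the left factor. -/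
theorem conjOp_add_left (M₁ M₂ M' : Matrix (Fin N) (Fin N) ℂ) : conjOp (M₁ + M₂) M' = conjOp M₁ M' + conjOp M₂ M' := by
  ext p q; simp [conjOp, add_mul]

/-- `conjOp` is additive in the right factor. -/
theorem conjOp_add_right (M M₁ M₂ : Matrix (Fin N) (Fin N) ℂ) : conjOp M (M₁ + M₂) = conjOp M M₁ + conjOp M M₂ := by
  ext p q; simp [conjOp, mul_add]

/-- `conjOp` respects subtraction in the left factor. -/
theorem conjOp_sub_left (M₁ M₂ M' : Matrix (Fin N) (Fin N) ℂ) : conjOp (M₁ - M₂) M' = conjOp M₁ M' - conjOp M₂ M' := by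
  ext p q; simp [conjOp, sub_mul]

/-- `conjOp` respects subtraction in the right factor. -/
theorem conjOp_sub_right (M M₁ M₂ : Matrix (Fin N) (Fin N) ℂ) : conjOp M (M₁ - M₂) = conjOp M M₁ - conjOp M M₂ := by
  ext p q; simp [conjOp, mul_sub]

/-- `conjOp 1 1 = 1` (`X ↦ X`). -/
theorem conjOp_one_one : conjOp (1 : Matrix (Fin N) (Fin N) ℂ) 1 = 1 := by
  ext p q
  simp only [conjOp, Matrix.of_apply, Matrix.one_apply]
  by_cases h1 : p.1 = q.1
  · by_cases h2 : q.2 = p.2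
    · have : p = q := Prod.ext h1 h2.symm
      simp [h2, this]
    · have : p ≠ q := fun h => h2 (by rw [h])
      simp [h1, h2, this]
  · have : p ≠ q := fun h => h1 (by rw [h])
    simp [this, h1]

/-- Column sums of a product under a uniform column-sum letter on the left factor. -/
theorem colSumNorm_mul_le (A B : Matrix (Fin N) (Fin N) ℂ) {α : ℝ} (hA : ∀ c, colSumNorm A c ≤ α) (b : Fin N) :
    colSumNorm (A * B) b ≤ α * colSumNorm B b := by
  unfold colSumNorm
  calc ∑ d, ‖(A * B) d b‖ ≤ ∑ d, ∑ c, ‖A d c‖ * ‖B c b‖ := Finset.sum_le_sum fun d _ => by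
          rw [Matrix.mul_apply]; exact (norm_sum_le _ _).trans (le_of_eq (Finset.sum_congr rfl fun c _ => norm_mul _ _))
    _ = ∑ c, (∑ d, ‖A d c‖) * ‖B c b‖ := by rw [Finset.sum_comm]; exact Finset.sum_congr rfl fun c _ => by rw [Finset.sum_mul]
    _ ≤ ∑ c, α * ‖B c b‖ := Finset.sum_le_sum fun c _ => mul_le_mul_of_nonneg_right (hA c) (norm_nonneg _)
    _ = α * ∑ c, ‖B c b‖ := by rw [Finset.mul_sum]

/-- Row sums of a product under a uniform row-sum letter on the right factor. -/
theorem rowSumNorm_mul_le (A B : Matrix (Fin N) (Fin N) ℂ) {β : ℝ} (hB : ∀ c, rowSumNorm B c ≤ β) (a : Fin N) :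
    rowSumNorm (A * B) a ≤ rowSumNorm A a * β := by
  unfold rowSumNorm
  calc ∑ c, ‖(A * B) a c‖ ≤ ∑ c, ∑ d, ‖A a d‖ * ‖B d c‖ := Finset.sum_le_sum fun c _ => by
          rw [Matrix.mul_apply]; exact (norm_sum_le _ _).trans (le_of_eq (Finset.sum_congr rfl fun d _ => norm_mul _ _))
    _ = ∑ d, ‖A a d‖ * ∑ c, ‖B d c‖ := by rw [Finset.sum_comm]; exact Finset.sum_congr rfl fun d _ => by rw [Finset.mul_sum]
    _ ≤ ∑ d, ‖A a d‖ * β := Finset.sum_le_sum fun d _ => mul_le_mul_of_nonneg_left (hB d) (norm_nonneg _)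
    _ = (∑ d, ‖A a d‖) * β := by rw [Finset.sum_mul]

/-- fibre row mass of a sum. -/
theorem rowMass_add_le (A B : Matrix (Fin N × Fin N) (Fin N × Fin N) ℂ) (p : Fin N × Fin N) :
    ∑ q, ‖(A + B) p q‖ ≤ ∑ q, ‖A p q‖ + ∑ q, ‖B p q‖ := by
  rw [← Finset.sum_add_distrib]; exact Finset.sum_le_sum fun q _ => norm_add_le _ _

/-- fibre row mass of a difference. -/
theorem rowMass_sub_le (A B : Matrix (Fin N × Fin N) (Fin N × Fin N) ℂ) (p : Fin N × Fin N) :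
    ∑ q, ‖(A - B) p q‖ ≤ ∑ q, ‖A p q‖ + ∑ q, ‖B p q‖ := by
  rw [← Finset.sum_add_distrib]; exact Finset.sum_le_sum fun q _ => norm_sub_le _ _

/-! ## §2. The transport defect and its BOND WINDOW -/

/-- **The transport defect decomposed**: `conjOp U U⁻ − 1 = conjOp (U − 1) U⁻ + conjOp 1 (U⁻ − 1)` (`UXU⁻ − X = (U − 1)XU⁻ + X(U⁻ − 1)`).
[cite: Balaban1985BackgroundPropagators, (3.51) p.400] -/
theorem conjOp_sub_one (U U' : Matrix (Fin N) (Fin N) ℂ) :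
    conjOp U U' - 1 = conjOp (U - 1) U' + conjOp 1 (U' - 1) := by
  rw [conjOp_sub_left, conjOp_sub_right, conjOp_one_one]; abel

/-- **THE BOND WINDOW**: `Σ_q |(conjOp U U⁻ − 1)_{(a,b),q}| ≤ rowSum(U − 1)_a·colSum(U⁻)_b + colSum(U⁻ − 1)_b` — `O(‖U − 1‖)`, print's
`ηα₁(Lʲη)⁻¹`. [cite: Balaban1985BackgroundPropagators, (3.37) p.396, (3.54) p.401] -/
theorem rowMass_defect_le (U U' : Matrix (Fin N) (Fin N) ℂ) (a b : Fin N) :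
    ∑ q, ‖(conjOp U U' - 1) (a, b) q‖ ≤ rowSumNorm (U - 1) a * colSumNorm U' b + colSumNorm (U' - 1) b := by
  rw [conjOp_sub_one]
  refine (rowMass_add_le _ _ _).trans ?_
  rw [rowMass_conjOp, rowMass_conjOp]
  have : rowSumNorm (1 : Matrix (Fin N) (Fin N) ℂ) a = 1 := by
    simp only [rowSumNorm, Matrix.one_apply]
    rw [Finset.sum_eq_single a (fun c _ hc => by rw [if_neg (Ne.symm hc), norm_zero]) (fun h => (h (Finset.mem_univ a)).elim)]
    simp
  rw [this, one_mul]

/-- The bond window under uniform letters: row ∕ column sums of `U − 1`, `U⁻ − 1` at most `δ` ⟹ row mass `≤ δ(1 + δ) + δ`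
(`colSum(U⁻) ≤ 1 + δ`). -/
theorem rowMass_defect_le_of_letters (U U' : Matrix (Fin N) (Fin N) ℂ) {δ : ℝ} (hδ : 0 ≤ δ)
    (hU : ∀ a, rowSumNorm (U - 1) a ≤ δ) (hU' : ∀ b, colSumNorm (U' - 1) b ≤ δ) (a b : Fin N) :
    ∑ q, ‖(conjOp U U' - 1) (a, b) q‖ ≤ δ * (1 + δ) + δ := by
  have hcol : colSumNorm U' b ≤ 1 + δ := by
    have e : U' = 1 + (U' - 1) := by abel
    calc colSumNorm U' b = colSumNorm (1 + (U' - 1)) b := by rw [← e]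
      _ ≤ colSumNorm (1 : Matrix (Fin N) (Fin N) ℂ) b + colSumNorm (U' - 1) b := by
          unfold colSumNorm; rw [← Finset.sum_add_distrib]
          exact Finset.sum_le_sum fun d _ => by rw [Matrix.add_apply]; exact norm_add_le _ _
      _ ≤ 1 + δ := by
          refine add_le_add (le_of_eq ?_) (hU' b)
          simp only [colSumNorm, Matrix.one_apply]
          rw [Finset.sum_eq_single b (fun d _ hd => by rw [if_neg hd, norm_zero]) (fun h => (h (Finset.mem_univ b)).elim)]
          simp
  refine (rowMass_defect_le U U' a b).trans ?_
  exact add_le_add (mul_le_mul (hU a) hcol (colSumNorm_nonneg _ _) hδ) (hU' b)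

/-! ## §3. The DIVERGENCE: first order `ad_{U − V}`, second order `O(δ²)` -/

/-- **THE DIVERGENCE IDENTITY**: for a forward transporter `U` (inverse `U⁻`, `UU⁻ = 1`) and the transporter `V` of the preceding bond
(inverse `V⁻`, `V⁻V = 1`), the sum of the two defects at the site is `ad_{U − V}` to first order:
`(conjOp U U⁻ − 1) + (conjOp V⁻ V − 1) = conjOp (U − V) 1 − conjOp 1 (U − V) + R₂`, with the four SECOND-order terms
`R₂ = conjOp (U−1)(U⁻−1) − conjOp 1 ((U−1)(U⁻−1)) + conjOp (V⁻−1)(V−1) − conjOp ((V⁻−1)(V−1)) 1`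
(print: «Σ_{b∈st(x)} … = i[(D*_U A)(x), λ(x)] + Σ_b F′_{1,k}(i ad_{A′(b)})λ(b₊)», (3.51)–(3.52)). [cite: Balaban1985BackgroundPropagators, (3.51)–(3.52) p.400] -/
theorem defect_pair_eq (U Ui V Vi : Matrix (Fin N) (Fin N) ℂ) (hU : U * Ui = 1) (hV : Vi * V = 1) :
    (conjOp U Ui - 1) + (conjOp Vi V - 1) =
      conjOp (U - V) 1 - conjOp 1 (U - V) +
        (conjOp (U - 1) (Ui - 1) - conjOp 1 ((U - 1) * (Ui - 1)) + conjOp (Vi - 1) (V - 1) - conjOp ((Vi - 1) * (V - 1)) 1) := by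
  have pU : (U - 1) * (Ui - 1) = 1 + 1 - U - Ui := by rw [sub_mul, one_mul, mul_sub, mul_one, hU]; abel
  have pV : (Vi - 1) * (V - 1) = 1 + 1 - Vi - V := by rw [sub_mul, one_mul, mul_sub, mul_one, hV]; abel
  rw [pU, pV]
  simp only [conjOp_sub_left, conjOp_sub_right, conjOp_add_left, conjOp_add_right, conjOp_one_one]
  abel

/-- **THE DIVERGENCE WINDOW**: under the letters — row AND column sums of `U − 1`, `U⁻ − 1`, `V − 1`, `V⁻ − 1` at most `δ ≥ 0`, of the
DISCRETE DERIVATIVE `U − V` at most `δ′` — the fibre row mass of the defect pair is `≤ 2δ′ + 4δ²` (print: `2dα₁(Lʲη)⁻²|λ| + 8dα₁²(Lʲη)⁻²|λ|`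
summed over the `d` axes). [cite: Balaban1985BackgroundPropagators, (3.54) p.401, (3.37) p.396] -/
theorem rowMass_defect_pair_le (U Ui V Vi : Matrix (Fin N) (Fin N) ℂ) (hU : U * Ui = 1) (hV : Vi * V = 1) {δ δ' : ℝ}
    (hδ : 0 ≤ δ)
    (hUr : ∀ a, rowSumNorm (U - 1) a ≤ δ) (hUc : ∀ b, colSumNorm (U - 1) b ≤ δ) (hUic : ∀ b, colSumNorm (Ui - 1) b ≤ δ)
    (hVr : ∀ a, rowSumNorm (V - 1) a ≤ δ) (hVc : ∀ b, colSumNorm (V - 1) b ≤ δ) (hVir : ∀ a, rowSumNorm (Vi - 1) a ≤ δ)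
    (hDr : ∀ a, rowSumNorm (U - V) a ≤ δ') (hDc : ∀ b, colSumNorm (U - V) b ≤ δ') (a b : Fin N) :
    ∑ q, ‖((conjOp U Ui - 1) + (conjOp Vi V - 1)) (a, b) q‖ ≤ 2 * δ' + 4 * δ ^ 2 := by
  have h1r : rowSumNorm (1 : Matrix (Fin N) (Fin N) ℂ) a = 1 := by
    simp only [rowSumNorm, Matrix.one_apply]
    rw [Finset.sum_eq_single a (fun c _ hc => by rw [if_neg (Ne.symm hc), norm_zero]) (fun h => (h (Finset.mem_univ a)).elim)]
    simp
  have h1c : colSumNorm (1 : Matrix (Fin N) (Fin N) ℂ) b = 1 := by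
    simp only [colSumNorm, Matrix.one_apply]
    rw [Finset.sum_eq_single b (fun d _ hd => by rw [if_neg hd, norm_zero]) (fun h => (h (Finset.mem_univ b)).elim)]
    simp
  -- first order: 2δ′
  have t1 : ∑ q, ‖(conjOp (U - V) 1 - conjOp 1 (U - V)) (a, b) q‖ ≤ 2 * δ' := by
    refine (rowMass_sub_le _ _ _).trans ?_
    rw [rowMass_conjOp, rowMass_conjOp, h1r, h1c, mul_one, one_mul]
    linarith [hDr a, hDc b]
  -- second order: each term ≤ δ²
  have t2 : ∑ q, ‖(conjOp (U - 1) (Ui - 1)) (a, b) q‖ ≤ δ ^ 2 := by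
    rw [rowMass_conjOp, pow_two]; exact mul_le_mul (hUr a) (hUic b) (colSumNorm_nonneg _ _) hδ
  have t3 : ∑ q, ‖(conjOp 1 ((U - 1) * (Ui - 1))) (a, b) q‖ ≤ δ ^ 2 := by
    rw [rowMass_conjOp, h1r, one_mul, pow_two]
    exact (colSumNorm_mul_le _ _ hUc b).trans (mul_le_mul_of_nonneg_left (hUic b) hδ)
  have t4 : ∑ q, ‖(conjOp (Vi - 1) (V - 1)) (a, b) q‖ ≤ δ ^ 2 := by
    rw [rowMass_conjOp, pow_two]; exact mul_le_mul (hVir a) (hVc b) (colSumNorm_nonneg _ _) hδ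
  have t5 : ∑ q, ‖(conjOp ((Vi - 1) * (V - 1)) 1) (a, b) q‖ ≤ δ ^ 2 := by
    rw [rowMass_conjOp, h1c, mul_one, pow_two]
    exact (rowSumNorm_mul_le _ _ hVr a).trans (mul_le_mul_of_nonneg_right (hVir a) hδ)
  have t25 := (rowMass_sub_le _ _ (a, b)).trans (add_le_add ((rowMass_add_le _ _ (a, b)).trans (add_le_add
    ((rowMass_sub_le _ _ (a, b)).trans (add_le_add t2 t3)) t4)) t5)
  rw [defect_pair_eq U Ui V Vi hU hV]
  refine ((rowMass_add_le _ _ (a, b)).trans (add_le_add t1 t25)).trans (le_of_eq ?_)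
  ring

end Summit.QuantumFields.BalabanUV.Gaps.D4WalkBlockTransportAlgebra

end
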